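import Mathlib
import HarnessLib
import Literature.NumberTheory.LFunctions.WeilExplicit
import Literature.NumberTheory.LFunctions.GeneralizedRH
import Literature.NumberTheory.LFunctions.EulerMaclaurinZetaHigher
import Literature.Barriers.RiemannHypothesis.TuranPartialSums
import Summits.RiemannHypothesis.RiemannHypothesis.Theses.WeilComb

/-!
# Sketch — crux-ideate `stmt-RiemannHypothesis-11229` (`WeilComb.CombShapePositivity`),
ideator k = 2, round 1 (2026-08-16).

First lemmas / line statements of the two idea cards, stated over existing declarations only
(no proofs claimed; this file must elaborate with rc 0):

* card `s-unit-comb-toeplitz-ladder`  — namespace `…Cruxes.CombShapePositivity.SUnitToeplitzLadder`;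
* card `pole-shadow-pair-sign`        — namespace `…Cruxes.CombShapePositivity.PoleShadowPairSign`.

Notation: `φ₀(u) = expNegInvGlue (1 - u^2)` (the crux's fixed bump), `φ_ε = ε⁻¹ φ₀(·/ε)`,
`Q = Literature.NumberTheory.LFunctions.weilQuadratic`, `W = weilFunctional`.
-/

noncomputable section

open scoped BigOperators ComplexConjugate
open Complex MeasureTheory Set

namespace Summit.RiemannHypothesis.RiemannHypothesis.Cruxes.CombShapePositivity

open Literature.NumberTheory.LFunctions

/-- The crux's dilated bump `φ_ε(t) = ε⁻¹ φ₀(t/ε)` as it literally appears inside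
`WeilComb.CombShapePositivity` (node at `y`: `φ_ε(x - y)`). -/
def phiE (ε : ℝ) (t : ℝ) : ℂ :=
  (ε : ℂ)⁻¹ * ((expNegInvGlue (1 - (t / ε) ^ 2) : ℝ) : ℂ)

/-- A comb on an arbitrary finite list of real nodes `y i` (i < n) with coefficients `a i`. -/
def nodeComb (ε : ℝ) (n : ℕ) (y : ℕ → ℝ) (a : ℕ → ℂ) : ℝ → ℂ :=
  fun x : ℝ => ∑ i ∈ Finset.range n, a i * phiE ε (x - y i)

/-- The integer comb of the crux, `g = Σ_{m=1}^{M} a_m φ_ε(· − log m)` (verbatim the function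
inside `WeilComb.CombShapePositivity`). -/
def comb (ε : ℝ) (M : ℕ) (a : ℕ → ℂ) : ℝ → ℂ :=
  fun x : ℝ => ∑ m ∈ Finset.Icc 1 M,
    a m * ((ε : ℂ)⁻¹ * ((expNegInvGlue (1 - ((x - Real.log (m : ℝ)) / ε) ^ 2) : ℝ) : ℂ))

/-- Sanity: the crux is literally positivity of `Q` on these combs. -/
example : Summit.RiemannHypothesis.RiemannHypothesis.Theses.WeilComb.CombShapePositivity ↔
    ∀ ε : ℝ, 0 < ε → ∀ (M : ℕ) (a : ℕ → ℂ), 0 ≤ (weilQuadratic (comb ε M a)).re := Iff.rfl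

/-- The autocorrelated bump `ψ_ε = φ_ε ⋆ φ̃_ε` and the comb kernel `w_ε(x) = W(τ_x ψ_ε)`
(`τ_x h = h(· − x)`); the Gram matrix of the crux is `[w_ε(log m − log m')]_{m,m' ≤ M}`. -/
def psiE (ε : ℝ) : ℝ → ℂ := weilConv (phiE ε) (weilReflect (phiE ε))

/-- The comb kernel `w_ε(x) := W(τ_x ψ_ε)`. -/
def wKernel (ε : ℝ) (x : ℝ) : ℂ := weilFunctional (fun t : ℝ => psiE ε (t - x))

/-! ## Card 1 — `s-unit-comb-toeplitz-ladder` -/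
namespace SUnitToeplitzLadder

/-- GEOMETRIC (single-prime) comb: nodes `j · log p`, `0 ≤ j ≤ J`. Its Gram matrix is the
TOEPLITZ matrix `[w_ε((j − j') log p)]`. -/
def geomComb (p : ℕ) (ε : ℝ) (J : ℕ) (a : ℕ → ℂ) : ℝ → ℂ :=
  nodeComb ε (J + 1) (fun j => (j : ℝ) * Real.log p) a

/-- `{2,3}`-UNIT comb: nodes `i log 2 + j log 3` (the 3-smooth integers `2^i 3^j`), Gram matrix
2-level Toeplitz in `(i − i', j − j')`. -/
def sUnitComb (ε : ℝ) (A B : ℕ) (a : ℕ → ℕ → ℂ) : ℝ → ℂ :=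
  fun x : ℝ => ∑ i ∈ Finset.range (A + 1), ∑ j ∈ Finset.range (B + 1),
    a i j * phiE ε (x - ((i : ℝ) * Real.log 2 + (j : ℝ) * Real.log 3))

/-- Positivity of `Q` on all geometric combs at the prime `p` (all `ε`, all lengths). -/
def GeomCombPositivity (p : ℕ) : Prop :=
  ∀ ε : ℝ, 0 < ε → ∀ (J : ℕ) (a : ℕ → ℂ), 0 ≤ (weilQuadratic (geomComb p ε J a)).re

/-- TRANSFER TARGET `C⁺`: positivity of `Q` on all `{2,3}`-unit combs. -/
def SUnitCombPositivity : Prop :=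
  ∀ ε : ℝ, 0 < ε → ∀ (A B : ℕ) (a : ℕ → ℕ → ℂ), 0 ≤ (weilQuadratic (sUnitComb ε A B a)).re

/-- FIRST LEMMA (a): `C⁺` is a special case of the crux (take `M = 2^A 3^B` and `a_m = a i j`
when `m = 2^i 3^j`, `0` otherwise; the two combs are the same function). Size S. -/
def SUnitOfCrux : Prop :=
  Summit.RiemannHypothesis.RiemannHypothesis.Theses.WeilComb.CombShapePositivity → SUnitCombPositivity

/-- FIRST LEMMA (b), the transfer back: `{2,3}`-unit comb positivity already gives RH — the
route's two-node detection (Path A of `CombShapeDetection`: translation invariance of `Q`,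
`WeilConverse.norm_expSum_le` polarised on a DENSE set of lags, continuity of `expSum`,
`BoundedPowerSum.sum_fiber_eq_zero_of_exp_real`) run on the dense subgroup `ℤ log 2 + ℤ log 3`
of `ℝ` instead of `log ℚ_{>0}`. Size M. With `CombConverse` (RH ⇒ crux, proved in evidence)
this closes the loop `crux ⇒ C⁺ ⇒ RH ⇒ crux`. -/
def SUnitDetection : Prop :=
  SUnitCombPositivity → RiemannHypothesis

/-- TOEPLITZ STRUCTURE (size S given the comb expansion `Q(g) = Σ a_i conj(a_j) w_ε(y_i − y_j)`):
the Gram matrix of a geometric comb depends on `j − j'` only. -/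
def GeomGramToeplitz : Prop :=
  ∀ (p : ℕ), 2 ≤ p → ∀ ε : ℝ, 0 < ε → ∀ (J : ℕ) (a : ℕ → ℂ),
    weilQuadratic (geomComb p ε J a) =
      ∑ j ∈ Finset.range (J + 1), ∑ j' ∈ Finset.range (J + 1),
        a j * conj (a j') * wKernel ε (((j : ℝ) - (j' : ℝ)) * Real.log p)

/-- UNCONDITIONAL RUNG (Chebyshev strength; size M/L): geometric combs at `p = 2` are Weil-positive
up to length `2^J ≤ c · ε⁻² · (log ε⁻¹)^2` — i.e. up to window `ε·M ≍ ε⁻¹ log² ε⁻¹ → ∞`, far beyond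
the dense-comb transition `ε·M ≍ 1`. Proof idea: Toeplitz + Gershgorin; `c₀ = w_ε(0) ≥
ε⁻¹‖φ₀‖²(log ε⁻¹ − C)`; exact-Euler-factor regime `2^n ε ≲ 1` costs `≤ 3.35·ε⁻¹‖φ₀‖²`;
beyond, Brun–Titchmarsh in the window `[2^n e^{−2ε}, 2^n e^{2ε}]` bounds `|c_n| ≤ C' 2^{n/2}`
(no `ε⁻¹`: window count `≍ ε 2^n` times spike height `≍ ε⁻¹`). -/
def GeomRungTwo : Prop :=
  ∃ c : ℝ, 0 < c ∧ ∃ ε₀ : ℝ, 0 < ε₀ ∧ ∀ ε : ℝ, 0 < ε → ε ≤ ε₀ → ∀ (J : ℕ) (a : ℕ → ℂ),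
    (2 : ℝ) ^ J ≤ c * ε⁻¹ ^ 2 * (Real.log ε⁻¹) ^ 2 → 0 ≤ (weilQuadratic (geomComb 2 ε J a)).re

/-- THE LADDER (conditional rungs; size L each): no zeros in `σ₀ < Re s < 1` buys geometric-comb
positivity up to length `2^J ≤ ε^{-A}` for every `A < 1/(σ₀ − 1/2)`; `σ₀ = 1/2` (RH) gives all
lengths (that last rung is `CombConverse`). Calibration: the frontier `M = ε^{-A}` is the comb face
of quasi-RH(`1/2 + 1/A`); rung `A = 2` is `GeomRungTwo`. -/
def GeomLadder : Prop :=
  ∀ σ₀ : ℝ, 1 / 2 < σ₀ → σ₀ < 1 → QuasiRiemannHypothesis σ₀ →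
    ∀ A : ℝ, 0 < A → A < 1 / (σ₀ - 1 / 2) → ∃ ε₀ : ℝ, 0 < ε₀ ∧
      ∀ ε : ℝ, 0 < ε → ε ≤ ε₀ → ∀ (J : ℕ) (a : ℕ → ℂ),
        (2 : ℝ) ^ J ≤ ε⁻¹ ^ A → 0 ≤ (weilQuadratic (geomComb 2 ε J a)).re

/-- CONVERSE CALIBRATION (Turán-type power-sum rigidity; size L; informs the negative side):
geometric-comb positivity up to `2^J ≤ ε^{-A}` for all small `ε` forces quasi-RH(`1/2 + 1/A`)
for the zeros in the visibility cone of the kernel (stated here in the clean global form, which is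
the target; the honest provable form may need `A' > A`). -/
def GeomLadderConverse : Prop :=
  ∀ A : ℝ, 2 ≤ A →
    (∃ ε₀ : ℝ, 0 < ε₀ ∧ ∀ ε : ℝ, 0 < ε → ε ≤ ε₀ → ∀ (J : ℕ) (a : ℕ → ℂ),
        (2 : ℝ) ^ J ≤ ε⁻¹ ^ A → 0 ≤ (weilQuadratic (geomComb 2 ε J a)).re) →
      QuasiRiemannHypothesis (1 / 2 + 1 / A)

/-- The Carathéodory/Toeplitz reformulation at one prime (size M given the explicit formula):
`GeomCombPositivity p` iff for every `ε` the sequence `n ↦ w_ε(n log p)` on `ℤ` is positive-definite,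
i.e. all its Toeplitz sections are PSD. -/
def GeomIffToeplitzPSD : Prop :=
  ∀ p : ℕ, 2 ≤ p →
    (GeomCombPositivity p ↔
      ∀ ε : ℝ, 0 < ε → ∀ (J : ℕ) (a : ℕ → ℂ),
        0 ≤ (∑ j ∈ Finset.range (J + 1), ∑ j' ∈ Finset.range (J + 1),
          a j * conj (a j') * wKernel ε (((j : ℝ) - (j' : ℝ)) * Real.log p)).re)

end SUnitToeplitzLadder

/-! ## Card 2 — `pole-shadow-pair-sign` -/
namespace PoleShadowPairSign

open Literature.Barriers.RiemannHypothesis (zetaPartialSum)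

/-- The Perron comb: `a_m = m^{-1/2}`; its comb transform is `Φ₀(ε(s−½)) · ζ_M(1 − s)`. -/
def perronComb (ε : ℝ) (M : ℕ) : ℝ → ℂ :=
  comb ε M (fun m => ((Real.sqrt (m : ℝ))⁻¹ : ℝ))

/-- Mollifier-shaped vectors `a = m^{-1/2} ⋆ b` (Dirichlet convolution with a short `b` of length
`L`): `a_m = Σ_{d | m, d ≤ L} b_d (m/d)^{-1/2}`; their comb transform is `Φ₀(ε(s−½)) ζ_{M/d}-sums · B`. -/
def mollVec (L : ℕ) (b : ℕ → ℂ) (m : ℕ) : ℂ :=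
  ∑ d ∈ (Nat.divisors m).filter (· ≤ L), b d * (((Real.sqrt ((m / d : ℕ) : ℝ))⁻¹ : ℝ) : ℂ)

/-- FIRST LEMMA (a) — the pole-shadow SIGN (pure algebra, size S): the universal main term of a
zero PAIR `{ρ, 1 − ρ̄}` on the mollifier space is `M · Re[1/(ρ(1−ρ))] · |B(ρ)|²`, and
`Re[1/(ρ(1−ρ))] > 0` throughout the critical strip — wherever the zero is horizontally. -/
def PoleShadowSign : Prop :=
  ∀ ρ : ℂ, 0 < ρ.re → ρ.re < 1 → ρ.im ≠ 0 → 0 < (1 / (ρ * (1 - ρ))).re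

/-- FIRST LEMMA (b) — AFE AT ZEROS (size M; from the tree's Euler–Maclaurin
`riemannZeta_eq_eulerMaclaurin_of_re_pos` of high order, or Hardy–Littlewood's crude approximate
functional equation, Titchmarsh Thm. 4.11, for the sharper range `|γ| ≤ M/C`): at every nontrivial
zero `ρ` the partial sum `ζ_M(ρ)` IS the pole shadow `M^{1−ρ}/(1−ρ)` up to `O(M^{-Re ρ})`, in the
range `|Im ρ| ≤ M^{1−η}`. -/
def AFEAtZeros : Prop :=
  ∀ η : ℝ, 0 < η → ∃ C : ℝ, 0 < C ∧ ∀ ρ : ℂ, riemannZeta ρ = 0 → 0 < ρ.re → ρ.re < 1 →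
    ∀ M : ℕ, 2 ≤ M → |ρ.im| ≤ (M : ℝ) ^ (1 - η) →
      ‖zetaPartialSum M ρ - (M : ℂ) ^ (1 - ρ) / (1 - ρ)‖ ≤ C * (M : ℝ) ^ (-ρ.re)

/-- LINE STATEMENT (unconditional theorem-candidate, size L): the Perron comb is Weil-positive in
every window `M^{η−1} ≤ ε ≤ 1` (any fixed `η > 0`, `M ≥ M₀(η)`), WITHOUT any hypothesis on the zeros
(`ε ≤ 1` keeps the phase of `Φ₀(ε(ρ−½))²` controlled for hypothetical off-line zeros; for `ε > 1`
all kernel weights are tiny and the sign question is a different, verification-flavoured one):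
by the explicit formula `Q = Σ_ρ Φ₀(ε(ρ−½))² ζ_M(1−ρ) ζ_M(ρ)`-type pair sums, `AFEAtZeros` and
`PoleShadowSign` make every pair term `≈ Φ₀² · M/|ρ|² > 0` for `|γ| ≤ ε⁻¹·K ≤ M^{1−η}K`, and the
kernel tail `|Φ₀(εγ)|² ≲ e^{−2√(εγ)}` beyond. (Sharper: `ε ≥ C (log M)²/M` with Titchmarsh 4.11.) -/
def PerronWindowPositivity : Prop :=
  ∀ η : ℝ, 0 < η → ∃ M₀ : ℕ, ∀ M : ℕ, M₀ ≤ M → ∀ ε : ℝ, (M : ℝ) ^ (η - 1) ≤ ε → ε ≤ 1 →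
    0 ≤ (weilQuadratic (perronComb ε M)).re

/-- Same on the mollifier space of length `L` (the observed near-kernel of the transition matrix). -/
def MollifierWindowPositivity : Prop :=
  ∀ η : ℝ, 0 < η → ∀ L : ℕ, ∃ M₀ : ℕ, ∀ M : ℕ, M₀ ≤ M → ∀ ε : ℝ, (M : ℝ) ^ (η - 1) ≤ ε → ε ≤ 1 →
    ∀ b : ℕ → ℂ, 0 ≤ (weilQuadratic (comb ε M (mollVec L b))).re

/-- How the line re-enters the crux (linear algebra, size S): with `K` the Hermitian Gram matrix of
the crux at `(M, ε)` and `𝓜` (= range of a projection `P`) the mollifier space: if `K` is STRICTLY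
positive on `𝓜` and non-negative on the `K`-orthogonal complement of `𝓜`, then `K ⪰ 0` (take the
`K`-projection `u*` of `v` onto `𝓜`, which exists by strictness; `⟨v,Kv⟩ = ⟨u*,Ku*⟩ + ⟨w,Kw⟩`).
The first hypothesis is `MollifierWindowPositivity` (strict form), the second is the honest
RH-strength residual (the crux with its observed near-kernel split off; NOT claimed easier). -/
def SchurSplit : Prop :=
  ∀ (n : ℕ) (K : Matrix (Fin n) (Fin n) ℂ), K.IsHermitian →
    ∀ (P : Matrix (Fin n) (Fin n) ℂ), P * P = P → P.IsHermitian →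
      (∀ v : Fin n → ℂ, P.mulVec v = v → v ≠ 0 → 0 < (star v ⬝ᵥ K.mulVec v).re) →
      (∀ v : Fin n → ℂ, (∀ u : Fin n → ℂ, P.mulVec u = u → star u ⬝ᵥ K.mulVec v = 0) →
          0 ≤ (star v ⬝ᵥ K.mulVec v).re) →
        ∀ v : Fin n → ℂ, 0 ≤ (star v ⬝ᵥ K.mulVec v).re

end PoleShadowPairSign

end Summit.RiemannHypothesis.RiemannHypothesis.Cruxes.CombShapePositivity

end
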